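import Literature.NumberTheory.GaloisCohomology.Howard2004.SelmerTriples
import Literature.NumberTheory.EllipticCurves.ZpExtensionEisensteinInvSystem
import Literature.NumberTheory.EllipticCurves.ZpExtensionEisensteinH1Limit
import Literature.NumberTheory.EllipticCurves.IwasawaAlgebraEisensteinCoefficientRingProofs
import HarnessLib

/-!
# The Eisenstein tower `k ↦ T_𝔮/p^k T_𝔮 = M_k ⊗ A_{m,k}(ψ)` as an instance of Howard's π-adic towers
# (`Howard2004.AdicTower` over the DVR `S_m = Λ/(T^m + p)`), and `lim_k H¹(K, T_𝔮/p^k) =` the pinned `H¹(K, T_𝔮)`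
# (definitions with bodies + rfl/bridge theorems; no named fact, no instance, no notation)

Topic `NumberTheory/EllipticCurves` (glue between the D1 lineage of cell `pub/bsd-print-x9` —
`ZpExtensionScalarTwist{,Maps}`, `ZpExtensionEisensteinInvSystem` (`EisensteinLevel`, its `S_m`-module structure),
`ZpExtensionEisensteinH1Data`/`…H1Limit` (the pinned `H¹(K, T_𝔮)` as compatible families) — and the typed
carrier of B. Howard, Compositio Math. 140 (2004) §1 in `GaloisCohomology/Howard2004/SelmerTriples` §F:
`Howard2004.AdicTower K R N`, `AdicTower.redH1`, `AdicTower.limitH1`, `AdicTower.limitSelmer`).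

Howard §1.6 (arXiv:1202.6340 p. 12, L29–55): for `R` a discrete valuation ring, `H¹_F(K, T) = lim_k H¹_F(K, T/𝔪^k T)`;
§2.2 / proof of Thm. 2.2.10 («taking `𝔮 = T^m + p`»): `T_𝔮 = 𝐓 ⊗_Λ S_𝔮`, `S_𝔮 = Λ/(q_m)` a DVR with uniformiser
`π`, `𝔪^{mk} = (π^{mk}) = (p^k)`, so the `p`-adic levels `T_𝔮/p^k T_𝔮` ARE the `𝔪`-adic levels of depth `mk`.
This file packages the tree's levels `EisensteinLevel p m M k = M_k ⊗ A_{m,k}(ψ)` (`A_{m,k} = S_m/p^k`), their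
`S_m`-linear `Γ_K`-action `κ.eisensteinTwist (ρ k) hm k` and the reductions `κ.eisensteinTwistReduce hm _ (t k)`
along a system of surjections `t k : M_{k+1} → M_k` as

* `ZpExtension.eisensteinLevelRed κ ρ t hm k : EisensteinLevel p m M (k+1) →ₗ[S_m] EisensteinLevel p m M k`,
  `ZpExtension.maximalIdeal_pow_mul_smul_eisensteinLevel` (`𝔪^{mk}` kills level `k`, from `π^{mk} = 0` in `A_{m,k}`,
  `IwasawaAlgebra.EisensteinCoeff.mk_X_pow_mul_eq_zero`);
* **`ZpExtension.eisensteinAdicTower κ ρ t hm ht : Howard2004.AdicTower K S_m (EisensteinLevel p m M)`**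
  (`hlin` = `S_m`-linearity of the twisted action; `killed k = ⟨m·k, _⟩`; `red_surjective` from `ht`);
* bridges: `eisensteinAdicTower_ρ`, `eisensteinAdicTower_red_apply`, **`redH1_eisensteinAdicTower`** (lit's
  `ContinuousRep.cohomologyMap` spelling of `H¹(red)` IS `galoisCohomology.map (eisensteinTwistReduce …) 1`),
  **`mem_limitH1_eisensteinAdicTower_iff`** and **`limitH1_eisensteinAdicTower_eq : T.limitH1 = κ.eisensteinH1LimitCarrier ρ t hm`**
  — Howard's `lim_k H¹(K, T_k)` of the typed §1.6 is, on the nose, the carrier of the pinned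
  `H¹(K, T_𝔮)` (`eisensteinH1Limit`, p638876) of the D1 road; and `mem_limitSelmer_eisensteinAdicTower_iff`
  (Selmer families = compatible families with levelwise Selmer components);
* `ZpExtension.eisensteinAdicTowerSucc` — the same tower re-indexed from level `1` (`e_k = m(k+1) > 0`, the
  indexing of part B's `DVRSetting`), with `redH1_eisensteinAdicTowerSucc`, `mem_limitH1_eisensteinAdicTowerSucc_iff`.

No statement about elliptic curves or Selmer groups of `E` is made here (the `E`-instance is `M k = E[p^k]`,
`t k = (P ↦ p·P)`); BSD is not proved by any of this.

References: [Howard2004HeegnerKolyvagin] §1.6 (arXiv p. 12, L29–55), §2.2, Def. 2.2.3, proof of Thm. 2.2.10;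
[Washington1997] §13.2.
-/

noncomputable section

open scoped TensorProduct ContRepresentation
open Field IsLocalRing

namespace Literature.NumberTheory.EllipticCurves.ZpExtension

open Literature.NumberTheory.GaloisRepresentations
open Literature.NumberTheory.GaloisCohomology.Howard2004

section Red

variable {K : Type} [Field K] {p : ℕ} [hp : Fact p.Prime] (κ : ZpExtension K p)
  {M : ℕ → Type} [∀ k, AddCommGroup (M k)] [∀ k, TopologicalSpace (M k)] [∀ k, DiscreteTopology (M k)]
  (ρ : ∀ k, DiscreteGaloisModule K (M k))
  (t : ∀ k, (ρ (k + 1)).toContRepresentation →ⁱL (ρ k).toContRepresentation)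
  {m : ℕ} (hm : 1 ≤ m)

/-! ## §1 The `S_m`-linear reductions of the levels; `𝔪^{mk}` kills level `k` -/

/-- **The reduction `M_{k+1} ⊗ A_{m,k+1}(ψ) → M_k ⊗ A_{m,k}(ψ)` as an `S_m = Λ/(q_m)`-linear map** between the level
carriers (`κ.eisensteinTwistReduce hm _ (t k)`; `S_m`-linearity from `eisensteinTwistReduce_mk_smul`).
[cite: Howard2004HeegnerKolyvagin, §2.2 and §1.6 (arXiv p. 12: the tower T/𝔪^k T)] -/
def eisensteinLevelRed (k : ℕ) :
    EisensteinLevel p m M (k + 1) →ₗ[IwasawaAlgebra p ⧸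
        Ideal.span {(PowerSeries.X ^ m + PowerSeries.C (p : ℤ_[p]) : IwasawaAlgebra p)}]
      EisensteinLevel p m M k where
  toFun x := (κ.eisensteinTwistReduce hm (Nat.le_succ k) (t k)
    (x : IwasawaAlgebra.EisensteinCoeff.Twisted p m (k + 1) (M (k + 1))) :
      IwasawaAlgebra.EisensteinCoeff.Twisted p m k (M k))
  map_add' x y := map_add _ _ _
  map_smul' c x := by
    obtain ⟨f, rfl⟩ := Ideal.Quotient.mk_surjective c
    rw [RingHom.id_apply, EisensteinLevel.quotient_mk_smul_def, EisensteinLevel.quotient_mk_smul_def]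
    exact κ.eisensteinTwistReduce_mk_smul hm (Nat.le_succ k) (t k) f _

/-- Unfolding `eisensteinLevelRed`: it is `eisensteinTwistReduce`. [cite: Howard2004HeegnerKolyvagin, §2.2] -/
@[simp]
theorem eisensteinLevelRed_apply (k : ℕ) (x : EisensteinLevel p m M (k + 1)) :
    κ.eisensteinLevelRed ρ t hm k x =
      κ.eisensteinTwistReduce hm (Nat.le_succ k) (t k)
        (x : IwasawaAlgebra.EisensteinCoeff.Twisted p m (k + 1) (M (k + 1))) :=
  rfl

omit [∀ k, TopologicalSpace (M k)] [∀ k, DiscreteTopology (M k)] in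
/-- **`𝔪^{mk}` kills the level `M_k ⊗ A_{m,k}`** (`𝔪 = (π) ⊂ S_m`, `π^{mk} = ±p^k = 0` in `A_{m,k}`): the
exponent in `AdicTower.killed` may be taken to be `m·k`.
[cite: Howard2004HeegnerKolyvagin, proof of Thm. 2.2.10 (𝔮 = T^m + p)] [cite: Washington1997, §13.2] -/
theorem maximalIdeal_pow_mul_smul_eisensteinLevel (k : ℕ)
    (r : IwasawaAlgebra p ⧸ Ideal.span {(PowerSeries.X ^ m + PowerSeries.C (p : ℤ_[p]) : IwasawaAlgebra p)})
    (hr : r ∈ @maximalIdeal _ _ (IwasawaAlgebra.isLocalRing_quotient_X_pow_add_C p hm) ^ (m * k))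
    (x : EisensteinLevel p m M k) : r • x = 0 := by
  letI := IwasawaAlgebra.isLocalRing_quotient_X_pow_add_C p hm
  rw [IwasawaAlgebra.maximalIdeal_quotient_X_pow_add_C_eq p hm, Ideal.span_singleton_pow,
    Ideal.mem_span_singleton'] at hr
  obtain ⟨c, rfl⟩ := hr
  obtain ⟨g, rfl⟩ := Ideal.Quotient.mk_surjective c
  have h : (Ideal.Quotient.mk
      (Ideal.span {(PowerSeries.X ^ m + PowerSeries.C (p : ℤ_[p]) : IwasawaAlgebra p)} ⊔
        Ideal.span {PowerSeries.C ((p : ℤ_[p]) ^ k)})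
      (g * PowerSeries.X ^ (m * k)) : IwasawaAlgebra.EisensteinCoeff p m k) = 0 := by
    rw [map_mul, map_pow (Ideal.Quotient.mk
        (Ideal.span {(PowerSeries.X ^ m + PowerSeries.C (p : ℤ_[p]) : IwasawaAlgebra p)} ⊔
          Ideal.span {PowerSeries.C ((p : ℤ_[p]) ^ k)})) PowerSeries.X (m * k),
      IwasawaAlgebra.EisensteinCoeff.mk_X_pow_mul_eq_zero, mul_zero]
  rw [← map_pow (Ideal.Quotient.mk
      (Ideal.span {(PowerSeries.X ^ m + PowerSeries.C (p : ℤ_[p]) : IwasawaAlgebra p)})) PowerSeries.X (m * k),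
    ← map_mul, EisensteinLevel.quotient_mk_smul_def, h, zero_smul]

end Red

section Tower

variable {K : Type} [Field K] {p : ℕ} [hp : Fact p.Prime] (κ : ZpExtension K p)
  {M : ℕ → Type} [∀ k, AddCommGroup (M k)] [∀ k, TopologicalSpace (M k)] [∀ k, DiscreteTopology (M k)]
  (ρ : ∀ k, DiscreteGaloisModule K (M k))
  (t : ∀ k, (ρ (k + 1)).toContRepresentation →ⁱL (ρ k).toContRepresentation)
  {m : ℕ} (hm : 1 ≤ m)

/-! ## §2 The tower -/

/-- **Howard's π-adic tower for the Eisenstein specialisation**: the levels `M_k ⊗ A_{m,k}(ψ)`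
(`EisensteinLevel p m M k`; for `M_k = E[p^k]`: `T_𝔮/p^k T_𝔮 = T_𝔮/𝔪^{mk} T_𝔮`) with their `S_m`-linear twisted
`Γ_K`-actions, killed by `𝔪^{mk} = (π^{mk}) = (p^k)`, and the surjective `S_m`-linear equivariant reductions along
`t k : M_{k+1} ↠ M_k`, as a term of lit's `Howard2004.AdicTower K S_m (EisensteinLevel p m M)` (`S_m = Λ/(q_m)` with
its local-ring structure `isLocalRing_quotient_X_pow_add_C`).
[cite: Howard2004HeegnerKolyvagin, §1.6 (arXiv p. 12, L29–55) and §2.2, proof of Thm. 2.2.10 (𝔮 = T^m + p)] -/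
def eisensteinAdicTower (ht : ∀ k, Function.Surjective (t k)) :
    letI := IwasawaAlgebra.isLocalRing_quotient_X_pow_add_C p hm
    AdicTower K (IwasawaAlgebra p ⧸
        Ideal.span {(PowerSeries.X ^ m + PowerSeries.C (p : ℤ_[p]) : IwasawaAlgebra p)})
      (EisensteinLevel p m M) :=
  letI := IwasawaAlgebra.isLocalRing_quotient_X_pow_add_C p hm
  { ρ := fun k ↦ (κ.eisensteinTwist (ρ k) hm k :
      ContinuousRep (absoluteGaloisGroup K) ℤ (EisensteinLevel p m M k))
    hlin := fun k σ c x ↦ by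
      obtain ⟨f, rfl⟩ := Ideal.Quotient.mk_surjective c
      rw [EisensteinLevel.quotient_mk_smul_def, EisensteinLevel.quotient_mk_smul_def]
      exact κ.eisensteinTwist_apply_smul (ρ k) hm k σ _ _
    killed := fun k ↦ ⟨m * k, fun r hr x ↦ maximalIdeal_pow_mul_smul_eisensteinLevel hm k r hr x⟩
    red := κ.eisensteinLevelRed ρ t hm
    red_surjective := fun k ↦ κ.eisensteinTwistReduce_surjective hm (Nat.le_succ k) (t k) (ht k)
    red_equivariant := fun k σ x ↦
      congrArg (fun φ ↦ φ x) ((κ.eisensteinTwistReduce hm (Nat.le_succ k) (t k)).isIntertwining' σ) }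

/-- The levels of the tower are the twisted modules `κ.eisensteinTwist (ρ k) hm k`.
[cite: Howard2004HeegnerKolyvagin, §2.2] -/
theorem eisensteinAdicTower_ρ (ht : ∀ k, Function.Surjective (t k)) (k : ℕ) :
    letI := IwasawaAlgebra.isLocalRing_quotient_X_pow_add_C p hm
    (κ.eisensteinAdicTower ρ t hm ht).ρ k =
      (κ.eisensteinTwist (ρ k) hm k : ContinuousRep (absoluteGaloisGroup K) ℤ (EisensteinLevel p m M k)) :=
  rfl

/-- The reductions of the tower are `eisensteinTwistReduce` along `t k`. [cite: Howard2004HeegnerKolyvagin, §2.2] -/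
theorem eisensteinAdicTower_red_apply (ht : ∀ k, Function.Surjective (t k)) (k : ℕ)
    (x : EisensteinLevel p m M (k + 1)) :
    letI := IwasawaAlgebra.isLocalRing_quotient_X_pow_add_C p hm
    (κ.eisensteinAdicTower ρ t hm ht).red k x =
      κ.eisensteinTwistReduce hm (Nat.le_succ k) (t k)
        (x : IwasawaAlgebra.EisensteinCoeff.Twisted p m (k + 1) (M (k + 1))) :=
  rfl

/-! ## §3 `lim_k H¹(K, T_k)` of the tower is the pinned `H¹(K, T_𝔮)` -/

/-- **`H¹(red)` in lit's spelling is `H¹(red)` in D1's spelling**: `AdicTower.redH1` of the Eisenstein tower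
(`ContinuousRep.cohomologyMap` of the reduction) is `galoisCohomology.map (κ.eisensteinTwistReduce hm _ (t k)) 1`
(both send the class of a continuous crossed homomorphism `φ` to the class of `red ∘ φ`).
[cite: Howard2004HeegnerKolyvagin, §1.6 (arXiv p. 12, L29–55)] [cite: SerreGaloisCohomology1997, I §2.2] -/
theorem redH1_eisensteinAdicTower (ht : ∀ k, Function.Surjective (t k)) (k : ℕ) :
    letI := IwasawaAlgebra.isLocalRing_quotient_X_pow_add_C p hm
    (κ.eisensteinAdicTower ρ t hm ht).redH1 k =
      galoisCohomology.map (κ.eisensteinTwistReduce hm (Nat.le_succ k) (t k)) 1 := by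
  letI := IwasawaAlgebra.isLocalRing_quotient_X_pow_add_C p hm
  refine AddMonoidHom.ext fun x ↦ ?_
  obtain ⟨φ, rfl⟩ := oneCocycleClass_surjective
    (DiscreteGaloisModule.toTopRep ((κ.eisensteinAdicTower ρ t hm ht).ρ (k + 1))) x
  change ContinuousCohomology.map _ _ 1 _ = ContinuousCohomology.map _ _ 1 _
  erw [map_oneCocycleClass]

/-- **Membership in `lim_k H¹(K, T_k)`** of the Eisenstein tower is compatibility under
`galoisCohomology.map (eisensteinTwistReduce …) 1` — the defining condition of the pinned limit
`κ.eisensteinH1LimitCarrier ρ t hm`. [cite: Howard2004HeegnerKolyvagin, §1.6 (arXiv p. 12, L29–55) and §2.2 (H¹(K, T_𝔮))] -/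
theorem mem_limitH1_eisensteinAdicTower_iff (ht : ∀ k, Function.Surjective (t k)) :
    letI := IwasawaAlgebra.isLocalRing_quotient_X_pow_add_C p hm
    ∀ x : ∀ k, galoisCohomology ((κ.eisensteinAdicTower ρ t hm ht).ρ k) 1,
      x ∈ (κ.eisensteinAdicTower ρ t hm ht).limitH1 ↔
        ∀ k, galoisCohomology.map (κ.eisensteinTwistReduce hm (Nat.le_succ k) (t k)) 1 (x (k + 1)) = x k := by
  letI := IwasawaAlgebra.isLocalRing_quotient_X_pow_add_C p hm
  intro x
  change (∀ k, (κ.eisensteinAdicTower ρ t hm ht).redH1 k (x (k + 1)) = x k) ↔ _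
  simp only [redH1_eisensteinAdicTower]
  exact Iff.rfl

/-- **`lim_k H¹(K, T_𝔮/p^k T_𝔮)` (Howard §1.6, typed) `=` the carrier of the pinned `H¹(K, T_𝔮)`** of the D1 road
(`κ.eisensteinH1LimitCarrier ρ t hm`, whose `EisensteinH1Data` is `κ.eisensteinH1Limit ρ t hm`).
[cite: Howard2004HeegnerKolyvagin, §1.6 (arXiv p. 12, L29–55) and §2.2, Def. 2.2.3 (H¹(K, T_𝔮))] -/
theorem limitH1_eisensteinAdicTower_eq (ht : ∀ k, Function.Surjective (t k)) :
    letI := IwasawaAlgebra.isLocalRing_quotient_X_pow_add_C p hm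
    (κ.eisensteinAdicTower ρ t hm ht).limitH1 = κ.eisensteinH1LimitCarrier ρ t hm := by
  letI := IwasawaAlgebra.isLocalRing_quotient_X_pow_add_C p hm
  exact AddSubgroup.ext fun x ↦ (κ.mem_limitH1_eisensteinAdicTower_iff ρ t hm ht x).trans
    (κ.mem_eisensteinH1LimitCarrier_iff ρ t hm x).symm

/-! ## §4 The shifted tower `k ↦ T_𝔮/p^{k+1} T_𝔮` (exponents `e_k = m(k+1) > 0`) -/

/-- **The same tower re-indexed from level `1`**: `k ↦ M_{k+1} ⊗ A_{m,k+1}(ψ) = T_𝔮/𝔪^{m(k+1)} T_𝔮`, so that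
every exponent `e_k = m(k+1)` is positive and strictly increasing (the indexing of lit's part B
`DVRSetting`/`SatisfiesH.e_zero`); fields as in `eisensteinAdicTower` one level up.
[cite: Howard2004HeegnerKolyvagin, §1.6 (arXiv p. 11 L18–20, p. 12 L29–55) and proof of Thm. 2.2.10] -/
def eisensteinAdicTowerSucc (ht : ∀ k, Function.Surjective (t k)) :
    letI := IwasawaAlgebra.isLocalRing_quotient_X_pow_add_C p hm
    AdicTower K (IwasawaAlgebra p ⧸
        Ideal.span {(PowerSeries.X ^ m + PowerSeries.C (p : ℤ_[p]) : IwasawaAlgebra p)})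
      (fun k ↦ EisensteinLevel p m M (k + 1)) :=
  letI := IwasawaAlgebra.isLocalRing_quotient_X_pow_add_C p hm
  { ρ := fun k ↦ (κ.eisensteinTwist (ρ (k + 1)) hm (k + 1) :
      ContinuousRep (absoluteGaloisGroup K) ℤ (EisensteinLevel p m M (k + 1)))
    hlin := fun k σ c x ↦ by
      obtain ⟨f, rfl⟩ := Ideal.Quotient.mk_surjective c
      rw [EisensteinLevel.quotient_mk_smul_def, EisensteinLevel.quotient_mk_smul_def]
      exact κ.eisensteinTwist_apply_smul (ρ (k + 1)) hm (k + 1) σ _ _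
    killed := fun k ↦ ⟨m * (k + 1), fun r hr x ↦ maximalIdeal_pow_mul_smul_eisensteinLevel hm (k + 1) r hr x⟩
    red := fun k ↦ κ.eisensteinLevelRed ρ t hm (k + 1)
    red_surjective := fun k ↦
      κ.eisensteinTwistReduce_surjective hm (Nat.le_succ (k + 1)) (t (k + 1)) (ht (k + 1))
    red_equivariant := fun k σ x ↦
      congrArg (fun φ ↦ φ x)
        ((κ.eisensteinTwistReduce hm (Nat.le_succ (k + 1)) (t (k + 1))).isIntertwining' σ) }

/-- The levels of the shifted tower. [cite: Howard2004HeegnerKolyvagin, §2.2] -/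
theorem eisensteinAdicTowerSucc_ρ (ht : ∀ k, Function.Surjective (t k)) (k : ℕ) :
    letI := IwasawaAlgebra.isLocalRing_quotient_X_pow_add_C p hm
    (κ.eisensteinAdicTowerSucc ρ t hm ht).ρ k =
      (κ.eisensteinTwist (ρ (k + 1)) hm (k + 1) :
        ContinuousRep (absoluteGaloisGroup K) ℤ (EisensteinLevel p m M (k + 1))) :=
  rfl

/-- The reductions of the shifted tower. [cite: Howard2004HeegnerKolyvagin, §2.2] -/
theorem eisensteinAdicTowerSucc_red_apply (ht : ∀ k, Function.Surjective (t k)) (k : ℕ)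
    (x : EisensteinLevel p m M (k + 1 + 1)) :
    letI := IwasawaAlgebra.isLocalRing_quotient_X_pow_add_C p hm
    (κ.eisensteinAdicTowerSucc ρ t hm ht).red k x =
      κ.eisensteinTwistReduce hm (Nat.le_succ (k + 1)) (t (k + 1))
        (x : IwasawaAlgebra.EisensteinCoeff.Twisted p m (k + 1 + 1) (M (k + 1 + 1))) :=
  rfl

/-- `H¹(red)` of the shifted tower in D1's spelling. [cite: Howard2004HeegnerKolyvagin, §1.6 (arXiv p. 12, L29–55)] -/
theorem redH1_eisensteinAdicTowerSucc (ht : ∀ k, Function.Surjective (t k)) (k : ℕ) :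
    letI := IwasawaAlgebra.isLocalRing_quotient_X_pow_add_C p hm
    (κ.eisensteinAdicTowerSucc ρ t hm ht).redH1 k =
      galoisCohomology.map (κ.eisensteinTwistReduce hm (Nat.le_succ (k + 1)) (t (k + 1))) 1 := by
  letI := IwasawaAlgebra.isLocalRing_quotient_X_pow_add_C p hm
  refine AddMonoidHom.ext fun x ↦ ?_
  obtain ⟨φ, rfl⟩ := oneCocycleClass_surjective
    (DiscreteGaloisModule.toTopRep ((κ.eisensteinAdicTowerSucc ρ t hm ht).ρ (k + 1))) x
  change ContinuousCohomology.map _ _ 1 _ = ContinuousCohomology.map _ _ 1 _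
  erw [map_oneCocycleClass]

/-- Membership in `lim_k H¹(K, T_{k+1})` of the shifted tower: compatibility from level `1` on.
[cite: Howard2004HeegnerKolyvagin, §1.6 (arXiv p. 12, L29–55)] -/
theorem mem_limitH1_eisensteinAdicTowerSucc_iff (ht : ∀ k, Function.Surjective (t k)) :
    letI := IwasawaAlgebra.isLocalRing_quotient_X_pow_add_C p hm
    ∀ x : ∀ k, galoisCohomology ((κ.eisensteinAdicTowerSucc ρ t hm ht).ρ k) 1,
      x ∈ (κ.eisensteinAdicTowerSucc ρ t hm ht).limitH1 ↔
        ∀ k, galoisCohomology.map (κ.eisensteinTwistReduce hm (Nat.le_succ (k + 1)) (t (k + 1))) 1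
          (x (k + 1)) = x k := by
  letI := IwasawaAlgebra.isLocalRing_quotient_X_pow_add_C p hm
  intro x
  change (∀ k, (κ.eisensteinAdicTowerSucc ρ t hm ht).redH1 k (x (k + 1)) = x k) ↔ _
  simp only [redH1_eisensteinAdicTowerSucc]
  exact Iff.rfl

end Tower

section Selmer

variable {K : Type} [Field K] [NumberField K] {p : ℕ} [hp : Fact p.Prime] (κ : ZpExtension K p)
  {M : ℕ → Type} [∀ k, AddCommGroup (M k)] [∀ k, TopologicalSpace (M k)] [∀ k, DiscreteTopology (M k)]
  (ρ : ∀ k, DiscreteGaloisModule K (M k))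
  (t : ∀ k, (ρ (k + 1)).toContRepresentation →ⁱL (ρ k).toContRepresentation)
  {m : ℕ} (hm : 1 ≤ m)

/-- **Membership in `lim_k H¹_{F_k}(K, T_k)`** (lit's `AdicTower.limitSelmer`) of the Eisenstein tower: a
compatible family (in D1's `galoisCohomology.map` currency) all of whose components are Selmer classes for the
levelwise structures `F k` — the shape of `EisensteinH1Data.selmerAddSubgroup` on the pinned limit.
[cite: Howard2004HeegnerKolyvagin, Def. 1.1.10 and §1.6 (arXiv pp. 6, 12)] -/
theorem mem_limitSelmer_eisensteinAdicTower_iff (ht : ∀ k, Function.Surjective (t k)) :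
    letI := IwasawaAlgebra.isLocalRing_quotient_X_pow_add_C p hm
    ∀ (F : ∀ k, DiscreteGaloisModule.SelmerStructure ((κ.eisensteinAdicTower ρ t hm ht).ρ k))
      (x : ∀ k, galoisCohomology ((κ.eisensteinAdicTower ρ t hm ht).ρ k) 1),
      x ∈ (κ.eisensteinAdicTower ρ t hm ht).limitSelmer F ↔
        (∀ k, galoisCohomology.map (κ.eisensteinTwistReduce hm (Nat.le_succ k) (t k)) 1 (x (k + 1)) = x k) ∧
          ∀ k, x k ∈ (F k).selmerGroup := by
  letI := IwasawaAlgebra.isLocalRing_quotient_X_pow_add_C p hm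
  intro F x
  refine ((κ.eisensteinAdicTower ρ t hm ht).mem_limitSelmer_iff F x).trans ?_
  simp only [redH1_eisensteinAdicTower]
  exact Iff.rfl

end Selmer

end Literature.NumberTheory.EllipticCurves.ZpExtension

end
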